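import Literature.AlgebraicGeometry.Resolution.WeightedCentreDirectionalDerivative
import Literature.AlgebraicGeometry.Resolution.WeightedCentreLayerEquation
import Mathlib.RingTheory.MvPolynomial.Homogeneous
import Mathlib.Tactic.LinearCombination
import Mathlib.Tactic.Ring
import HarnessLib

/-!
# Linear rigidity core: a polynomial kernel direction becomes a missing variable (CARVER task T43)

INSTRUMENT, NOT a resolution theorem: the pure-algebra core of LEMMAS U / N′ / T (THEOREM-L5N
eng1-g36 §11, linear rigidity of the classes `U′ = 2/9`, `N′ = 5/24`, `T = 1/5`) of ENGINE 1's
polynomial weighted-centre TOY MODEL `W(f)`.  Over a field `K` of characteristic `p`: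

* T43 CLAIM 2 after the class-linear change (the load-bearing statement): if `r : σ → K` is a
  kernel direction of `P`, `D_r P := Σ_k r_k • ∂_k P = 0`, and the exponents of `X_{u₀}` stay below
  `p` (e.g. `P` homogeneous of degree `d < p`), then after the linear substitution `A = lineSubst u₀ r`
  (`A e_{u₀} = r`, `A e_j = e_j` otherwise; a graded automorphism of the class when `r_{u₀} ≠ 0`)
  the variable `X_{u₀}` does not occur in `P ∘ A` (`notMem_vars_lineSubst*`): "the slot `u₀` lies
  in no monomial of `P″`, hence is unpinned".  This is the tree's chain rule
  `pderiv_lineSubst_eq_zero` followed by the derivative criterion `notMem_vars_of_pderiv_eq_zero`;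
  the file only glues them in the shape §11 uses (support / homogeneous / `Fintype` / family forms).
* T43 CLAIM 1 (translation invariance, for every scalar `s`): under the same hypotheses and
  `r_{u₀} ≠ 0`, `P(X + s·r) = P(X)` as polynomials (`aeval_translate_eq_self`), obtained by
  conjugating the `X_{u₀}`-translation with `A`.

Bookkeeping only; NOT a statement about the Abramovich–Temkin–Włodarczyk invariant; nothing here is
summit progress; AI-written, AI review weaker than expert review.  References (context only):
[Hironaka1970AdditiveGroups] (additive forms and differential operators),
[AbramovichTemkinWlodarczyk2024] §5.2.
-/

namespace Literature.AlgebraicGeometry.Resolution.WeightedBlowup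

namespace LinearRigidity

open MvPolynomial

variable {K : Type*} [Field K] {σ : Type*} [DecidableEq σ]

/-- **T43 core (support form).** `D_r P = 0` (with `r` supported on `B`) and every exponent of
`X_{u₀}` in `P ∘ A` below `p` ⇒ `X_{u₀} ∉ vars (P ∘ A)`, `A = lineSubst u₀ r`.
[cite: Hironaka1970AdditiveGroups, additive forms and differential operators] -/
theorem notMem_vars_lineSubst (p : ℕ) [CharP K p] (u₀ : σ) {r : σ → K} (B : Finset σ)
    (hr : ∀ k ∉ B, r k = 0) {P : MvPolynomial σ K} (hD : ∑ k ∈ B, r k • pderiv k P = 0)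
    (hlt : ∀ m ∈ (lineSubst u₀ r P).support, m u₀ < p) : u₀ ∉ (lineSubst u₀ r P).vars :=
  notMem_vars_of_pderiv_eq_zero p (pderiv_lineSubst_eq_zero u₀ B hr hD) hlt

/-- `lineSubst` preserves (ordinary) homogeneity of every degree (all variables weigh `1`).
[cite: AbramovichTemkinWlodarczyk2024, §5.2] -/
theorem isHomogeneous_lineSubst (u₀ : σ) (r : σ → K) {P : MvPolynomial σ K} {d : ℕ}
    (hP : P.IsHomogeneous d) : (lineSubst u₀ r P).IsHomogeneous d :=
  isWeightedHomogeneous_lineSubst u₀ (1 : σ → ℕ) (fun _ _ => rfl) hP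

/-- **T43 core (homogeneous form; the shape of §11).** `P` homogeneous of degree `d < p = char K`,
`D_r P = Σ_{k ∈ B} r_k • ∂_k P = 0` ⇒ `X_{u₀}` does not occur in `P ∘ lineSubst u₀ r`.
[cite: Hironaka1970AdditiveGroups, additive forms and differential operators] -/
theorem notMem_vars_lineSubst_of_isHomogeneous (p : ℕ) [CharP K p] (u₀ : σ) {r : σ → K}
    (B : Finset σ) (hr : ∀ k ∉ B, r k = 0) {P : MvPolynomial σ K} {d : ℕ}
    (hP : P.IsHomogeneous d) (hd : d < p) (hD : ∑ k ∈ B, r k • pderiv k P = 0) :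
    u₀ ∉ (lineSubst u₀ r P).vars :=
  notMem_vars_of_pderiv_eq_zero_of_totalDegree_lt p (pderiv_lineSubst_eq_zero u₀ B hr hD)
    (lt_of_le_of_lt (isHomogeneous_lineSubst u₀ r hP).totalDegree_le hd)

/-- The same over a finite index type, `D_r P = Σ_k r_k • ∂_k P` summed over all variables.
[cite: Hironaka1970AdditiveGroups, additive forms and differential operators] -/
theorem notMem_vars_lineSubst_of_isHomogeneous' [Fintype σ] (p : ℕ) [CharP K p] (u₀ : σ)
    (r : σ → K) {P : MvPolynomial σ K} {d : ℕ} (hP : P.IsHomogeneous d) (hd : d < p)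
    (hD : ∑ k, r k • pderiv k P = 0) : u₀ ∉ (lineSubst u₀ r P).vars :=
  notMem_vars_lineSubst_of_isHomogeneous p u₀ Finset.univ (fun k hk => absurd (Finset.mem_univ k) hk)
    hP hd hD

/-- **Family form (LEMMA U as used):** a common kernel direction `r` of the forms `P i` (`i ∈ S`,
all homogeneous of degree `d < p`) leaves `X_{u₀}` in none of the `P i ∘ lineSubst u₀ r`.
[cite: Hironaka1970AdditiveGroups, additive forms and differential operators] -/
theorem notMem_vars_lineSubst_family [Fintype σ] (p : ℕ) [CharP K p] (u₀ : σ) (r : σ → K)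
    {ι : Type*} (S : Finset ι) (P : ι → MvPolynomial σ K) {d : ℕ}
    (hP : ∀ i ∈ S, (P i).IsHomogeneous d) (hd : d < p)
    (hD : ∀ i ∈ S, ∑ k, r k • pderiv k (P i) = 0) :
    ∀ i ∈ S, u₀ ∉ (lineSubst u₀ r (P i)).vars :=
  fun i hi => notMem_vars_lineSubst_of_isHomogeneous' p u₀ r (hP i hi) hd (hD i hi)

/-! ## CLAIM 1: translation invariance along the kernel direction -/

/-- The translation `X_j ↦ X_j + s r_j` (substitution hom).
[cite: AbramovichTemkinWlodarczyk2024, §5.2] -/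
noncomputable def translate (r : σ → K) (s : K) : MvPolynomial σ K →ₐ[K] MvPolynomial σ K :=
  aeval fun j => X j + C (s * r j)

/-- The coordinate translation `X_{u₀} ↦ X_{u₀} + s`, other variables fixed.
[cite: AbramovichTemkinWlodarczyk2024, §5.2] -/
noncomputable def translateCoord (u₀ : σ) (s : K) : MvPolynomial σ K →ₐ[K] MvPolynomial σ K :=
  aeval fun j => if j = u₀ then X u₀ + C s else X j

/-- A polynomial without `X_{u₀}` is fixed by the `X_{u₀}`-translation.
[cite: AbramovichTemkinWlodarczyk2024, §5.2] -/
theorem translateCoord_eq_self_of_notMem_vars (u₀ : σ) (s : K) {S : MvPolynomial σ K}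
    (hS : u₀ ∉ S.vars) : translateCoord u₀ s S = S := by
  have h := hom_congr_vars (f₁ := (translateCoord u₀ s : MvPolynomial σ K →ₐ[K] MvPolynomial σ K).toRingHom)
    (f₂ := RingHom.id (MvPolynomial σ K)) (p₁ := S) (p₂ := S)
    (by ext a; simp [translateCoord])
    (fun i hi _ => by
      have hne : i ≠ u₀ := fun h => hS (h ▸ hi)
      simp [translateCoord, hne])
    rfl
  simpa using h

/-- Conjugation: `lineSubstInv ∘ translateCoord u₀ s ∘ lineSubst = translate r s` when `r_{u₀} ≠ 0`
(`A τ A⁻¹` is the translation by `s · A e_{u₀} = s · r`).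
[cite: AbramovichTemkinWlodarczyk2024, §5.2] -/
theorem lineSubstInv_comp_translateCoord_comp_lineSubst (u₀ : σ) {r : σ → K} (hr0 : r u₀ ≠ 0)
    (s : K) :
    (lineSubstInv u₀ r).comp ((translateCoord u₀ s).comp (lineSubst u₀ r)) = translate r s := by
  apply MvPolynomial.algHom_ext
  intro j
  have h0 : C (r u₀) * C (r u₀)⁻¹ = (1 : MvPolynomial σ K) := by
    rw [← C_mul, mul_inv_cancel₀ hr0, C_1]
  have hA : lineSubst u₀ r (X j) = lineGen u₀ r j := by
    show aeval _ (X j) = _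
    rw [aeval_X]
  have hT : ∀ i, translateCoord u₀ s (X i) = if i = u₀ then X u₀ + C s else X i := fun i => by
    show aeval _ (X i) = _
    rw [aeval_X]
  have hI : ∀ i, lineSubstInv u₀ r (X i) = lineGenInv u₀ r i := fun i => by
    show aeval _ (X i) = _
    rw [aeval_X]
  have hR : translate r s (X j) = X j + C (s * r j) := by
    show aeval _ (X j) = _
    rw [aeval_X]
  rw [AlgHom.comp_apply, AlgHom.comp_apply, hA, hR, lineGen]
  by_cases hj : j = u₀
  · subst hj
    simp only [if_true, map_mul, algHom_C, MvPolynomial.algebraMap_eq, hT, map_add, hI,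
      lineGenInv]
    linear_combination (X j) * h0
  · simp only [if_neg hj, map_add, map_mul, algHom_C, MvPolynomial.algebraMap_eq, hT, if_true,
      hI, lineGenInv]
    ring

/-- **T43 CLAIM 1 (translation invariance along a kernel direction).** `P` homogeneous of degree
`d < p = char K`, `D_r P = 0`, `r_{u₀} ≠ 0` ⇒ `P(X + s·r) = P(X)` for every scalar `s`.
[cite: Hironaka1970AdditiveGroups, additive forms and differential operators] -/
theorem aeval_translate_eq_self [Fintype σ] (p : ℕ) [CharP K p] {r : σ → K} {u₀ : σ}
    (hr0 : r u₀ ≠ 0) {P : MvPolynomial σ K} {d : ℕ} (hP : P.IsHomogeneous d) (hd : d < p)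
    (hD : ∑ k, r k • pderiv k P = 0) (s : K) : translate r s P = P := by
  have hvars := notMem_vars_lineSubst_of_isHomogeneous' p u₀ r hP hd hD
  have h1 : translateCoord u₀ s (lineSubst u₀ r P) = lineSubst u₀ r P :=
    translateCoord_eq_self_of_notMem_vars u₀ s hvars
  have h2 : lineSubstInv u₀ r (lineSubst u₀ r P) = P := by
    have h := congrArg (fun φ => φ P) (lineSubstInv_comp_lineSubst u₀ hr0)
    simpa using h
  have h3 := congrArg (fun φ => φ P) (lineSubstInv_comp_translateCoord_comp_lineSubst u₀ hr0 s)
  simp only [AlgHom.comp_apply] at h3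
  rw [← h3, h1, h2]

end LinearRigidity

end Literature.AlgebraicGeometry.Resolution.WeightedBlowup
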